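import Mathlib
import HarnessLib
import Summits.AtomisticToContinuum.Crystallization.Theses.PricedLinkCensus

/-!
# Sketch — crux-ideate round 1, ideator 1, crux `PricedLinkCensus.ChargedEnergyGap`
(item stmt-AtomisticToContinuum-14231).

First lemmas of the two idea cards (`Ideas/stable-charge-only.md`,
`Ideas/two-tolerance-sandwich.md`).  Nothing here is proved; every `theorem` is a SIGNATURE that
must elaborate (proof `sorry`).  Namespace of the crux's idea space.
-/

noncomputable section

open scoped BigOperators
open Filter Set Function

namespace Summit.AtomisticToContinuum.Crystallization.Cruxes.ChargedEnergyGap.Sketch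

open Literature.MathematicalPhysics.StatisticalMechanics
open Literature.Geometry.DiscreteGeometry
open Summit.AtomisticToContinuum.Crystallization.Theses.PricedLinkCensus

local notation "E³" => EuclideanSpace ℝ (Fin 3)

/-- `e* = ⨅` over periodic configurations of the Lennard-Jones energy per particle
(the constant of the crux). -/
def eStar : ℝ :=
  ⨅ Q : PeriodicConfiguration 3, Q.energyPerParticle lennardJones

/-- number of sites of a finite configuration that are NOT charge-free at tolerance `η`. -/
def chargedCount (η : ℝ) {N : ℕ} (y : Fin N → E³) : ℕ :=
  Nat.card {i : Fin N // ¬ IsChargeFree η y i}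

/-- The crux at a general tolerance `η` (the route's decl is `η = 1/100`). -/
def ChargedEnergyGapAt (η : ℝ) : Prop :=
  ∃ κ C : ℝ, 0 < κ ∧ ∀ (N : ℕ) (y : Fin N → E³), Function.Injective y →
    (N : ℝ) * eStar + κ * (chargedCount η y : ℝ) - C * (N : ℝ) ^ (2 / 3 : ℝ) ≤
      interactionEnergy lennardJones y

/-- sanity: at `η = 1/100` this is literally the route decl. -/
theorem chargedEnergyGapAt_one_div :
    ChargedEnergyGapAt (1 / 100) ↔ ChargedEnergyGap := Iff.rfl

/-! ## Card `stable-charge-only` — frame: the surface allowance is worthless, periodic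
configurations suffice -/

/-- The crux with NO surface allowance (`C = 0`). -/
def ChargedEnergyGap₀ : Prop :=
  ∃ κ : ℝ, 0 < κ ∧ ∀ (N : ℕ) (y : Fin N → E³), Function.Injective y →
    (N : ℝ) * eStar + κ * (chargedCount (1 / 100) y : ℝ) ≤ interactionEnergy lennardJones y

/-- SLACK REMOVAL (two-parameter Fekete): `k` far-apart copies of `y` have `k·#charged(y)`
charged sites and energy `≤ k·E(y)` (all cross terms `V_LJ(r) < 0` for `r ≥ 1`), so dividing
the crux for the union by `k` and letting `k → ∞` kills `C·(kN)^{2/3}/k`. -/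
theorem slack_removal : ChargedEnergyGap ↔ ChargedEnergyGap₀ := by
  sorry

/-- charged fraction of the motif of a periodic configuration, the charge being read in the
INFINITE point set `Q.points` (index type `↥Q.points`; `IsChargeFree` is stated for any index
type). -/
def chargedFraction (Q : PeriodicConfiguration 3) : ℝ :=
  (Nat.card {x : ↥Q.motif //
      ¬ IsChargeFree (1 / 100 : ℝ) (fun p : ↥Q.points => (p : E³))
        ⟨(x : E³), Q.mem_points_of_mem_motif x.2⟩} : ℝ) / (Q.motif.card : ℝ)

/-- PERIODIC FORM of the crux: among periodic configurations, link charge costs linearly. -/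
def PeriodicChargedGap : Prop :=
  ∃ κ : ℝ, 0 < κ ∧ ∀ Q : PeriodicConfiguration 3,
    eStar + κ * chargedFraction Q ≤ Q.energyPerParticle lennardJones

/-- FIRST LEMMA of card `stable-charge-only` (frame half): periodic configurations suffice.
Padding-periodisation of a finite `y` with period `L ≫ diam y + 1`: cross terms with the images
are `< 0`, the motif's charge is `y`'s charge (bond graphs are local at the own scale), hence
`e(Q_y) ≤ E(y)/N` and `chargedFraction Q_y = #charged(y)/N`. The converse direction takes big
blocks of `Q` as trial configurations. -/
theorem periodic_suffices : PeriodicChargedGap ↔ ChargedEnergyGap := by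
  sorry

/-! ## Card `stable-charge-only` — the lever in finite (bracket) form -/

/-- certified gain of a LOCAL SURGERY `y ↦ y'` when `e*` is only known through the bracket
`-1.193 ≤ e* ≤ -0.7175` (Yuhjtman's stability constant `14.316/12`; trial hcp lattice sum):
`E(y) - N e* ≥ [E(y) - E(y')] + (N' - N) e*`, and `(N' - N) e*` is bounded below by
`-1.193 (N' - N)` for insertions, by `0.7175 (N - N')` for deletions. -/
def bracketGain {N N' : ℕ} (y : Fin N → E³) (y' : Fin N' → E³) : ℝ :=
  interactionEnergy lennardJones y - interactionEnergy lennardJones y' +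
    (if N ≤ N' then -(1.193 : ℝ) * ((N' : ℝ) - N) else (0.7175 : ℝ) * ((N : ℝ) - N'))

/-- site `i` of `y` is `(g₀, r)`-SURGERY-STABLE: no injective configuration `y'` that agrees with
`y` (as a point SET) outside the ball of radius `r · nn_i` about `y i` has bracket gain `≥ g₀`. -/
def IsSurgeryStable (g₀ r : ℝ) {N : ℕ} (y : Fin N → E³) (i : Fin N) : Prop :=
  ∀ (N' : ℕ) (y' : Fin N' → E³), Function.Injective y' →
    Set.range y' \ Metric.ball (y i) (r * nearestDist y i) =
      Set.range y \ Metric.ball (y i) (r * nearestDist y i) →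
    bracketGain y y' < g₀

/-- PRICE ONLY STABLE CHARGE: charged sites that are surgery-stable cost `κ` each. -/
def StableChargeGap (g₀ r : ℝ) : Prop :=
  ∃ κ C : ℝ, 0 < κ ∧ ∀ (N : ℕ) (y : Fin N → E³), Function.Injective y →
    (N : ℝ) * eStar +
        κ * (Nat.card {i : Fin N // ¬ IsChargeFree (1 / 100 : ℝ) y i ∧ IsSurgeryStable g₀ r y i} : ℝ)
        - C * (N : ℝ) ^ (2 / 3 : ℝ) ≤ interactionEnergy lennardJones y

/-- FIRST LEMMA of card `stable-charge-only` (lever half): UNSTABLE CHARGE PAYS FOR ITSELF.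
Given the bracket on `e*`, for any surgery scale `(g₀, r)` it suffices to price surgery-stable
charged sites: a maximal `3r`-separated family of unstable sites is operated on simultaneously
(gains add up to `r⁻⁶`-tail corrections), the operated configuration still satisfies
`E ≥ N' e*` (Fekete/periodisation, no constant), and the family has `≥ #unstable / C(r)` members
by the hard core that near-optimality forces. `κ := min (κ_stable, g₀ / 2C(r)) / 2`. -/
theorem stable_charge_suffices (hlo : (-1.193 : ℝ) ≤ eStar) (hhi : eStar ≤ -0.7175)
    {g₀ r : ℝ} (hg : 0 < g₀) (hr : 2 < r) :
    StableChargeGap g₀ r → ChargedEnergyGap := by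
  sorry

/-! ## Card `two-tolerance-sandwich` -/

/-- COMBINATORIAL HALF (exact): a site charge-free at `3 %` but charged at `1 %` has, in its
`3 %`-star, a bond that is not a `1 %`-bond — i.e. a pair `(j,k)`, `j ∈ {i} ∪ N₃(i)`, with
`dist (y j) (y k) ∈ ((1.01)·m, (1.03)·m]`, `m = min (nn_j) (nn_k)`: an ELASTIC-BAND bond.
(`bondGraph_mono`: `N₁ ⊆ N₃`; either `#N₁(i) < 12`, or some ring number drops, which needs a
`3 %`-bond `j ∼ k`, `j ∈ N₃(i)`, absent at `1 %`.) -/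
theorem band_bond_of_charged (N : ℕ) (y : Fin N → E³) (i : Fin N)
    (h₃ : IsChargeFree (3 / 100 : ℝ) y i) (h₁ : ¬ IsChargeFree (1 / 100 : ℝ) y i) :
    ∃ j k : Fin N, (j = i ∨ (bondGraph (3 / 100 : ℝ) y).Adj i j) ∧
      (bondGraph (3 / 100 : ℝ) y).Adj j k ∧ ¬ (bondGraph (1 / 100 : ℝ) y).Adj j k := by
  sorry

/-- GEOMETRIC HALF (soft kissing rigidity; Tammes-13 at 4.55 %, the √2 gap of the two Barlow
links): lowering the tolerance from `3 %` to `1 %` never UNcharges a site. -/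
def ChargeMonotone : Prop :=
  ∀ (N : ℕ) (y : Fin N → E³) (i : Fin N),
    IsChargeFree (1 / 100 : ℝ) y i → IsChargeFree (3 / 100 : ℝ) y i

/-- ELASTIC-BAND PRICING: sites with a Barlow-topology link at `3 %` that are charged at `1 %`
(threshold-strain species, the binding one: κ ≤ 1.5e-4 from basal-sheared hcp) are priced by
relative phonon/Cauchy–Born coercivity of the Barlow family — `e_Barlow ≥ e*` needs no
knowledge of `e*`. -/
def ElasticBandPricing : Prop :=
  ∃ c C : ℝ, 0 < c ∧ ∀ (N : ℕ) (y : Fin N → E³), Function.Injective y →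
    c * (Nat.card {i : Fin N // IsChargeFree (3 / 100 : ℝ) y i ∧ ¬ IsChargeFree (1 / 100 : ℝ) y i} : ℝ)
      ≤ interactionEnergy lennardJones y - (N : ℝ) * eStar + C * (N : ℝ) ^ (2 / 3 : ℝ)

/-- FIRST LEMMA of card `two-tolerance-sandwich`: the crux at `1 %` is the crux for TOPOLOGICAL
charge (tolerance `3 %`, where threshold strain costs 9× more and no new species appears) plus
elastic-band pricing; two lower bounds for the same non-negative excess are averaged,
`κ := min (κ₃, c) / 2`. -/
theorem sandwich : ChargedEnergyGapAt (3 / 100) → ElasticBandPricing → ChargedEnergyGap := by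
  sorry

/-- and conversely (given monotonicity of charge in the tolerance) nothing is lost. -/
theorem sandwich_converse (hm : ChargeMonotone) :
    ChargedEnergyGap → ChargedEnergyGapAt (3 / 100) ∧ ElasticBandPricing := by
  sorry

end Summit.AtomisticToContinuum.Crystallization.Cruxes.ChargedEnergyGap.Sketch

end
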